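import Summits.FinalStateConjecture.FinalStateConjecture.Theorems.PhaseMixingCaptureBulkKerrCaptureC2CentreKerrFamily
import Summits.FinalStateConjecture.FinalStateConjecture.Theorems.PhaseMixingCaptureBulkKerrCaptureC2SobolevDilation
import Literature.Geometry.Lorentzian.InitialDataHomothety
import Literature.Geometry.Lorentzian.ChartSecondFundamentalFormDilation
import Literature.Geometry.Lorentzian.KerrSchildHomogeneity
import Literature.Geometry.Lorentzian.KerrSchildCoord
import HarnessLib

/-!
# Crux `PhaseMixingCapture.BulkKerrCaptureC2` (stmt-FinalStateConjecture-14985): SCALE COVARIANCE of the data ball —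
# the data side of the mass normalisation `M ↦ 1`

Support file for the crux `BulkKerrCaptureC2` (sub-extremal Kerr capture in the bulk, import grade), companion of
`…ScalingDevelopment.lean` (the conclusion of the crux descends from the shrink) and `…SobolevDilation.lean` (the
weighted Sobolev seminorms under `y ↦ l y`).  For `l > 0` and a datum `D` on the big slice `Kerr.slice (la) (lM)`, the
**shrink** `D₀ = ((sliceShrinkHomeomorph l)⁻¹^* D).homothety l⁻¹` is a datum on `Kerr.slice a M`.  This file proves
that the shrink carries the HYPOTHESES of the crux's matrix `CaptureC2At s δ M _ ε η a` at mass `lM` to those at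
mass `M`:

* `hFun_shrink`, `kFun_shrink` — its Cartesian components are `h₀(y) = h(l y)`, `k₀(y) = l k(l y)` (junk values
  included: `y ∈ Kerr.slice a M ↔ l y ∈ Kerr.slice (la) (lM)`, `Kerr.mem_slice_dilate_iff`);
* `isVacuumConstraintSolution_shrink` — it solves the vacuum constraints if `D` does (diffeomorphism
  equivariance and homothety covariance of the constraint map, Bartnik–Isenberg 2004, §2);
* `shrink_kerrData` — **the shrink of the Kerr datum of mass `lM` is the Kerr datum of mass `M`**:
  `((sliceShrinkHomeomorph l)⁻¹^* Kerr.data (lM) (la) (lM)).homothety l⁻¹ = Kerr.data M a M` (homogeneity of the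
  Kerr–Schild chart, `Kerr.bilin_dilate`; the slice embeddings `y ↦ (0, y)` and the future unit normals
  `(1 + 2H)^{-1/2} V` correspond under the dilation, `Kerr.scalarH_dilate`, `Kerr.timeVector_dilate`, so the induced
  metrics match and the second fundamental forms scale by `l⁻¹`, `OpensChart.secondFundamentalForm_dilate`);
* `dataWeightedSobolevEDist_shrink_le` — **the `H^s_δ × H^{s-1}_{δ+1}` distance of two shrinks is at most
  `K(l, s, δ)` times the distance of the data** (`weightedSobolevSeminorm_comp_smul_le`,
  `weightedSobolevSeminorm_const_smul_le`), so finiteness of all the distances to the centre and `ε`-closeness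
  pass from `D` (about `Kerr.data (lM) (la) (lM)`) to `D₀` (about `Kerr.data M a M`).

Everything is proved; no definitions, no named facts.  References: R. Bartnik, J. Isenberg, *The constraint
equations* (2004), §2; R. P. Kerr, A. Schild (1965), §2; M. Visser, arXiv:0706.0622, (32)–(35); G. B. Cook, Living
Rev. Relativ. 3 (2000) 5, §3.2.2; B. O'Neill 1983, Ch. 4, Lemma 4.4; R. Bartnik, CPAM 39 (1986), (1.2)–(1.3).
-/

-- the doubled `FinalStateConjecture.FinalStateConjecture` path component trips dupNamespace
set_option linter.dupNamespace false

noncomputable section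

open Set Function Topology TopologicalSpace
open scoped Manifold ContDiff Topology
open Literature.Geometry.Lorentzian
open Summit.FinalStateConjecture.FinalStateConjecture.Theorems.BulkKerrCaptureC2.Centre
  (sliceScale_smooth mfderiv_sliceScale_apply)

namespace Summit.FinalStateConjecture.FinalStateConjecture.Theorems.BulkKerrCaptureC2.Scaling

variable {M a l : ℝ}

/-! ## §1 The shrink of a datum: Cartesian components and the vacuum constraints -/

section Components

variable (hl : 0 < l)
include hl

/-- The slice dilation `(sliceShrinkHomeomorph l)⁻¹ : Kerr.slice a M → Kerr.slice (la) (lM)` is `y ↦ l y` on the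
underlying points. [folklore] -/
theorem coe_sliceShrinkHomeomorph_symm (y : Kerr.slice a M) :
    (((Kerr.sliceShrinkHomeomorph l hl a M).symm y : Kerr.slice (l * a) (l * M)) : E3) = l • (y : E3) := rfl

/-- The differential of the slice dilation is `v ↦ l v`. [folklore] -/
theorem mfderiv_sliceShrinkHomeomorph_symm_apply (y : Kerr.slice a M) (v : E3) :
    mfderiv (𝓡 3) (𝓡 3) (Kerr.sliceShrinkHomeomorph l hl a M).symm y v = l • v :=
  mfderiv_sliceScale_apply hl y v

omit hl in
/-- Bilinearity, at the type `E3 →L[ℝ] E3 →L[ℝ] ℝ` of the Cartesian components: `B(c v, c w) = c (c B(v, w))`.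
[folklore] -/
theorem apply_smul_smul (B : E3 →L[ℝ] E3 →L[ℝ] ℝ) (c : ℝ) (v w : E3) : B (c • v) (c • w) = c * (c * B v w) := by
  simp only [map_smul, FunLike.coe_smul, Pi.smul_apply, smul_eq_mul]

/-- **The metric components of the shrink**: `h₀(y) = h(l y)` as bilinear forms on `ℝ³`, for EVERY `y ∈ ℝ³`
(on the slice: `l⁻² h_{ly}(l v, l w) = h_{ly}(v, w)`; off the slice both are the junk value `δ`, since
`y ∈ Kerr.slice a M ↔ l y ∈ Kerr.slice (la) (lM)`). Bartnik–Isenberg 2004, §2. [cite: BartnikIsenberg2004, §2] -/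
theorem hFun_shrink (D : InitialDataSet 𝓘(ℝ, E3) (Kerr.slice (l * a) (l * M))) (y : E3) :
    ((D.comap (Kerr.sliceShrinkHomeomorph l hl a M).symm (sliceScale_smooth hl a M).1
        (sliceScale_smooth hl a M).2).homothety l⁻¹ (inv_pos.2 hl)).hFun y = D.hFun (l • y) := by
  by_cases hy : y ∈ Kerr.slice a M
  · have hly : l • y ∈ Kerr.slice (l * a) (l * M) := (Kerr.mem_slice_dilate_iff hl).2 hy
    rw [InitialDataSet.hFun_of_mem _ hy, InitialDataSet.hFun_of_mem _ hly]
    refine ContinuousLinearMap.ext fun v ↦ ContinuousLinearMap.ext fun w ↦ ?_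
    have e3 : D.h.inner ((Kerr.sliceShrinkHomeomorph l hl a M).symm ⟨y, hy⟩)
        (mfderiv (𝓡 3) (𝓡 3) (Kerr.sliceShrinkHomeomorph l hl a M).symm ⟨y, hy⟩ v)
        (mfderiv (𝓡 3) (𝓡 3) (Kerr.sliceShrinkHomeomorph l hl a M).symm ⟨y, hy⟩ w) =
        l * (l * D.h.inner ⟨l • y, hly⟩ v w) := by
      rw [mfderiv_sliceShrinkHomeomorph_symm_apply hl, mfderiv_sliceShrinkHomeomorph_symm_apply hl]
      exact apply_smul_smul (show E3 →L[ℝ] E3 →L[ℝ] ℝ from D.h.inner ⟨l • y, hly⟩) l v w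
    rw [InitialDataSet.homothety_h_inner, InitialDataSet.comap_h_inner, e3]
    change l⁻¹ ^ 2 * (l * (l * D.h.inner ⟨l • y, hly⟩ v w)) = D.h.inner ⟨l • y, hly⟩ v w
    have hl0 : l ≠ 0 := hl.ne'
    field_simp
  · have hly : l • y ∉ Kerr.slice (l * a) (l * M) := fun h ↦ hy ((Kerr.mem_slice_dilate_iff hl).1 h)
    rw [InitialDataSet.hFun_of_not_mem _ hy, InitialDataSet.hFun_of_not_mem _ hly]

/-- **The components of `k` of the shrink**: `k₀(y) = l k(l y)` as bilinear forms on `ℝ³`, for every `y ∈ ℝ³`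
(on the slice: `l⁻¹ k_{ly}(l v, l w) = l k_{ly}(v, w)`; off the slice both vanish). Bartnik–Isenberg 2004, §2.
[cite: BartnikIsenberg2004, §2] -/
theorem kFun_shrink (D : InitialDataSet 𝓘(ℝ, E3) (Kerr.slice (l * a) (l * M))) (y : E3) :
    ((D.comap (Kerr.sliceShrinkHomeomorph l hl a M).symm (sliceScale_smooth hl a M).1
        (sliceScale_smooth hl a M).2).homothety l⁻¹ (inv_pos.2 hl)).kFun y = l • D.kFun (l • y) := by
  by_cases hy : y ∈ Kerr.slice a M
  · have hly : l • y ∈ Kerr.slice (l * a) (l * M) := (Kerr.mem_slice_dilate_iff hl).2 hy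
    rw [InitialDataSet.kFun_of_mem _ hy, InitialDataSet.kFun_of_mem _ hly]
    refine ContinuousLinearMap.ext fun v ↦ ContinuousLinearMap.ext fun w ↦ ?_
    have e3 : D.k ((Kerr.sliceShrinkHomeomorph l hl a M).symm ⟨y, hy⟩)
        (mfderiv (𝓡 3) (𝓡 3) (Kerr.sliceShrinkHomeomorph l hl a M).symm ⟨y, hy⟩ v)
        (mfderiv (𝓡 3) (𝓡 3) (Kerr.sliceShrinkHomeomorph l hl a M).symm ⟨y, hy⟩ w) =
        l * (l * D.k ⟨l • y, hly⟩ v w) := by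
      rw [mfderiv_sliceShrinkHomeomorph_symm_apply hl, mfderiv_sliceShrinkHomeomorph_symm_apply hl]
      exact apply_smul_smul (show E3 →L[ℝ] E3 →L[ℝ] ℝ from D.k ⟨l • y, hly⟩) l v w
    rw [InitialDataSet.homothety_k, InitialDataSet.comap_k, e3]
    change l⁻¹ * (l * (l * D.k ⟨l • y, hly⟩ v w)) = l * D.k ⟨l • y, hly⟩ v w
    have hl0 : l ≠ 0 := hl.ne'
    field_simp
  · have hly : l • y ∉ Kerr.slice (l * a) (l * M) := fun h ↦ hy ((Kerr.mem_slice_dilate_iff hl).1 h)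
    rw [InitialDataSet.kFun_of_not_mem _ hy, InitialDataSet.kFun_of_not_mem _ hly]
    refine ContinuousLinearMap.ext fun v ↦ ContinuousLinearMap.ext fun w ↦ ?_
    simp

/-- **The shrink of a vacuum datum is vacuum**: pull-backs along local diffeomorphisms
(`isVacuumConstraintSolution_comap'`) and homotheties (`isVacuumConstraintSolution_homothety_iff`) of vacuum
data are vacuum. Bartnik–Isenberg 2004, §2. [cite: BartnikIsenberg2004, §2] -/
theorem isVacuumConstraintSolution_shrink (D : InitialDataSet 𝓘(ℝ, E3) (Kerr.slice (l * a) (l * M)))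
    [D.metric.HasLeviCivita]
    [((D.comap (Kerr.sliceShrinkHomeomorph l hl a M).symm (sliceScale_smooth hl a M).1
        (sliceScale_smooth hl a M).2).homothety l⁻¹ (inv_pos.2 hl)).metric.HasLeviCivita]
    (hD : D.IsVacuumConstraintSolution) :
    ((D.comap (Kerr.sliceShrinkHomeomorph l hl a M).symm (sliceScale_smooth hl a M).1
        (sliceScale_smooth hl a M).2).homothety l⁻¹ (inv_pos.2 hl)).IsVacuumConstraintSolution := by
  haveI := (D.comap (Kerr.sliceShrinkHomeomorph l hl a M).symm (sliceScale_smooth hl a M).1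
    (sliceScale_smooth hl a M).2).metric.hasLeviCivita
  exact ((D.comap (Kerr.sliceShrinkHomeomorph l hl a M).symm (sliceScale_smooth hl a M).1
    (sliceScale_smooth hl a M).2).isVacuumConstraintSolution_homothety_iff (inv_pos.2 hl)).2
    (D.isVacuumConstraintSolution_comap' _ _ hD)

end Components

/-! ## §2 The shrink of the Kerr datum of mass `lM` is the Kerr datum of mass `M` -/

section KerrData

variable [Kerr.Facts] [Kerr.SliceFacts]

omit [Kerr.SliceFacts] in
/-- The components of the Kerr–Schild metric of the dilated parameters are the original components read at
`x'/l`: `g_{lM,la}(x') = g_{M,a}(x'/l)`. Kerr–Schild 1965, §2 (homogeneity). [cite: KerrSchild1965, §2] -/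
theorem smoothMetric_val_dilate' (hl : 0 < l) (x' : Kerr.region (l * a) (l * M)) :
    (Kerr.smoothMetric (l * M) (l * a) (l * M)).val x' = Kerr.bilin M a (l⁻¹ • (x' : E4)) := by
  rw [Kerr.smoothMetric_val]
  conv_lhs => rw [show (x' : E4) = l • (l⁻¹ • (x' : E4)) by
    rw [smul_smul, mul_inv_cancel₀ hl.ne', one_smul]]
  exact Kerr.bilin_dilate hl M a _

/-- **The shrink of the Kerr datum of mass `lM` is the Kerr datum of mass `M`**:
`((sliceShrinkHomeomorph l)⁻¹^* Kerr.data (lM) (la) (lM)).homothety l⁻¹ = Kerr.data M a M` on `Kerr.slice a M`.  The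
slice embeddings `y ↦ (0, y)` correspond under the dilation (`(0, z) = l (0, z/l)`), the metric components are
dilation invariant (`Kerr.bilin_dilate`), and so is the future unit normal `ν = (1 + 2H)^{-1/2} V`
(`Kerr.scalarH_dilate`, `Kerr.timeVector_dilate`); hence the induced metrics match,
`l⁻² h_{lM,la}(ly)(lv, lw) = h_{M,a}(y)(v, w)`, and the second fundamental forms scale,
`K_{lM,la}(ly) = l⁻¹ K_{M,a}(y)` (`OpensChart.secondFundamentalForm_dilate`), so
`l⁻¹ k_{lM,la}(ly)(lv, lw) = k_{M,a}(y)(v, w)`.  Kerr–Schild 1965, §2; Cook 2000, §3.2.2; O'Neill 1983, Ch. 4,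
Lemma 4.4. [cite: KerrSchild1965, §2] -/
theorem shrink_kerrData (hM : 0 ≤ M) (hl : 0 < l) (hlM : 0 ≤ l * M) :
    ((Kerr.data (l * M) (l * a) (l * M) hlM).comap (Kerr.sliceShrinkHomeomorph l hl a M).symm
        (sliceScale_smooth hl a M).1 (sliceScale_smooth hl a M).2).homothety l⁻¹ (inv_pos.2 hl) =
      Kerr.data M a M hM := by
  have hl0 : l ≠ 0 := hl.ne'
  -- the transport data of `OpensChart.secondFundamentalForm_dilate`
  have hσ : ∀ z : Kerr.slice (l * a) (l * M),
      ((Kerr.sliceShrink l hl a M z : Kerr.slice a M) : E3) = l⁻¹ • (z : E3) := Kerr.coe_sliceShrink hl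
  have hpt : ∀ z : Kerr.slice (l * a) (l * M), E4.ofTimeSpace 0 (z : E3) =
      l • E4.ofTimeSpace 0 ((Kerr.sliceShrink l hl a M z : Kerr.slice a M) : E3) := fun z ↦ by
    rw [hσ, ← E4.ofTimeSpace_zero_smul, smul_smul, mul_inv_cancel₀ hl0, one_smul]
  have hf' : ∀ z : Kerr.slice (l * a) (l * M), (Kerr.sliceEmbed (l * a) (l * M) z : E4) =
      l • (Kerr.sliceEmbed a M (Kerr.sliceShrink l hl a M z) : E4) := fun z ↦ by
    rw [Kerr.coe_sliceEmbed, Kerr.coe_sliceEmbed, hpt]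
  have hν' : ∀ z : Kerr.slice (l * a) (l * M), (Kerr.sliceNormal (l * M) (l * a) (l * M) z : E4) =
      Kerr.sliceNormal M a M (Kerr.sliceShrink l hl a M z) := fun z ↦ by
    rw [Kerr.sliceNormal_apply, Kerr.sliceNormal_apply, hpt, Kerr.scalarH_dilate hl, Kerr.timeVector_dilate hl]
  have hG : ∀ x : Kerr.region a M, (Kerr.smoothMetric M a M).val x = Kerr.bilin M a x :=
    Kerr.smoothMetric_val M a M
  have hG' : ∀ x' : Kerr.region (l * a) (l * M),
      (Kerr.smoothMetric (l * M) (l * a) (l * M)).val x' = Kerr.bilin M a (l⁻¹ • (x' : E4)) :=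
    smoothMetric_val_dilate' hl
  have hfd : ∀ y, MDifferentiableAt 𝓘(ℝ, E3) 𝓘(ℝ, E4) (Kerr.sliceEmbed a M) y := fun y ↦
    (Kerr.contMDiff_sliceEmbed a M 1).mdifferentiableAt one_ne_zero
  have hdf : ∀ (z : Kerr.slice (l * a) (l * M)) (v : E3),
      mfderiv 𝓘(ℝ, E3) 𝓘(ℝ, E4) (Kerr.sliceEmbed (l * a) (l * M)) z v =
        mfderiv 𝓘(ℝ, E3) 𝓘(ℝ, E4) (Kerr.sliceEmbed a M) (Kerr.sliceShrink l hl a M z) v := fun z v ↦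
    OpensChart.mfderiv_dilate_apply hl hσ hf' (hfd _) v
  -- `F⁻¹ ∘ F = id` on the small slice
  have hFy : ∀ y : Kerr.slice a M,
      Kerr.sliceShrink l hl a M ((Kerr.sliceShrinkHomeomorph l hl a M).symm y) = y := fun y ↦
    Kerr.sliceShrink_sliceScale hl y
  refine InitialDataSet.ext' (fun y v w ↦ ?_) (fun y v w ↦ ?_)
  · -- the metric: `l⁻² h_{lM,la}(ly)(lv, lw) = h_{M,a}(y)(v, w)`
    have e3 : (Kerr.data (l * M) (l * a) (l * M) hlM).h.inner ((Kerr.sliceShrinkHomeomorph l hl a M).symm y)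
        (mfderiv (𝓡 3) (𝓡 3) (Kerr.sliceShrinkHomeomorph l hl a M).symm y v)
        (mfderiv (𝓡 3) (𝓡 3) (Kerr.sliceShrinkHomeomorph l hl a M).symm y w) =
        l * (l * (Kerr.data (l * M) (l * a) (l * M) hlM).h.inner ((Kerr.sliceShrinkHomeomorph l hl a M).symm y)
          v w) := by
      rw [mfderiv_sliceShrinkHomeomorph_symm_apply hl, mfderiv_sliceShrinkHomeomorph_symm_apply hl]
      exact apply_smul_smul (show E3 →L[ℝ] E3 →L[ℝ] ℝ from
        (Kerr.data (l * M) (l * a) (l * M) hlM).h.inner ((Kerr.sliceShrinkHomeomorph l hl a M).symm y)) l v w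
    have e4 : (Kerr.data (l * M) (l * a) (l * M) hlM).h.inner ((Kerr.sliceShrinkHomeomorph l hl a M).symm y) v w =
        (Kerr.data M a M hM).h.inner y v w := by
      rw [Kerr.data_h_inner, Kerr.data_h_inner, PseudoRiemannianMetric.inducedBilin_apply,
        PseudoRiemannianMetric.inducedBilin_apply, hdf, hdf, hG', hG, OpensChart.inv_smul_coe_eq hl hf', hFy]
      rfl
    rw [InitialDataSet.homothety_h_inner, InitialDataSet.comap_h_inner, e3, e4]
    field_simp
  · -- the second fundamental form: `l⁻¹ k_{lM,la}(ly)(lv, lw) = k_{M,a}(y)(v, w)`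
    have e3 : (Kerr.data (l * M) (l * a) (l * M) hlM).k ((Kerr.sliceShrinkHomeomorph l hl a M).symm y)
        (mfderiv (𝓡 3) (𝓡 3) (Kerr.sliceShrinkHomeomorph l hl a M).symm y v)
        (mfderiv (𝓡 3) (𝓡 3) (Kerr.sliceShrinkHomeomorph l hl a M).symm y w) =
        l * (l * (Kerr.data (l * M) (l * a) (l * M) hlM).k ((Kerr.sliceShrinkHomeomorph l hl a M).symm y) v w) := by
      rw [mfderiv_sliceShrinkHomeomorph_symm_apply hl, mfderiv_sliceShrinkHomeomorph_symm_apply hl]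
      exact apply_smul_smul (show E3 →L[ℝ] E3 →L[ℝ] ℝ from
        (Kerr.data (l * M) (l * a) (l * M) hlM).k ((Kerr.sliceShrinkHomeomorph l hl a M).symm y)) l v w
    have hsff := OpensChart.secondFundamentalForm_dilate
      (g := (Kerr.smoothMetric M a M).toPseudoRiemannianMetric)
      (g' := (Kerr.smoothMetric (l * M) (l * a) (l * M)).toPseudoRiemannianMetric)
      hl hσ hf' hG hG' hν' (hfd _) (Kerr.differentiableAt_bilin M a _)
      (z := (Kerr.sliceShrinkHomeomorph l hl a M).symm y)
    have svw : (Kerr.smoothMetric (l * M) (l * a) (l * M)).secondFundamentalForm 𝓘(ℝ, E3)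
        (Kerr.sliceEmbed (l * a) (l * M)) (Kerr.sliceNormal (l * M) (l * a) (l * M))
        ((Kerr.sliceShrinkHomeomorph l hl a M).symm y) v w =
      l⁻¹ * (Kerr.smoothMetric M a M).secondFundamentalForm 𝓘(ℝ, E3) (Kerr.sliceEmbed a M)
        (Kerr.sliceNormal M a M) (Kerr.sliceShrink l hl a M ((Kerr.sliceShrinkHomeomorph l hl a M).symm y)) v w :=
      LinearMap.congr_fun₂ hsff v w
    have e4 : (Kerr.data (l * M) (l * a) (l * M) hlM).k ((Kerr.sliceShrinkHomeomorph l hl a M).symm y) v w =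
        l⁻¹ * (Kerr.data M a M hM).k y v w := by
      rw [Kerr.data_k, Kerr.data_k, Kerr.sliceK_apply, Kerr.sliceK_apply, svw, hFy]
    rw [InitialDataSet.homothety_k, InitialDataSet.comap_k, e3, e4]
    field_simp

end KerrData

/-! ## §3 The data distance of two shrinks -/

section Distance

/-- **The `H^s_δ × H^{s-1}_{δ+1}` distance of two shrinks is controlled by the distance of the data**: for `l > 0`,
`s, δ` there is `K = K(l, s, δ) > 0` with `dist_{s,δ}(D₁⁰, D₂⁰) ≤ K · dist_{s,δ}(D₁, D₂)` for all `a, M` and all data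
`D₁, D₂` on `Kerr.slice (la) (lM)` — the constant does NOT depend on the spin, which is what a uniform basin `ε` over
`|a| ≤ a₁ M` needs (the component
differences of the shrinks are `(h₁ − h₂) ∘ (l ·)` and `l ((k₁ − k₂) ∘ (l ·))`, `hFun_shrink`, `kFun_shrink`; then
`weightedSobolevSeminorm_comp_smul_le` and `weightedSobolevSeminorm_const_smul_le`). Bartnik 1986, (1.2)–(1.3);
Bartnik–Isenberg 2004, §2. [cite: Bartnik1986, (1.2)] -/
theorem dataWeightedSobolevEDist_shrink_le (hl : 0 < l) (s : ℕ) (δ : ℝ) :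
    ∃ K : ℝ, 0 < K ∧ ∀ (a M : ℝ) (D₁ D₂ : InitialDataSet 𝓘(ℝ, E3) (Kerr.slice (l * a) (l * M))),
      InitialDataSet.dataWeightedSobolevEDist s δ
          ((D₁.comap (Kerr.sliceShrinkHomeomorph l hl a M).symm (sliceScale_smooth hl a M).1
            (sliceScale_smooth hl a M).2).homothety l⁻¹ (inv_pos.2 hl))
          ((D₂.comap (Kerr.sliceShrinkHomeomorph l hl a M).symm (sliceScale_smooth hl a M).1
            (sliceScale_smooth hl a M).2).homothety l⁻¹ (inv_pos.2 hl)) ≤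
        ENNReal.ofReal K * InitialDataSet.dataWeightedSobolevEDist s δ D₁ D₂ := by
  obtain ⟨K₁, hK₁, H₁⟩ := weightedSobolevSeminorm_comp_smul_le (G := E3 →L[ℝ] E3 →L[ℝ] ℝ) hl s δ
  obtain ⟨K₂, hK₂, H₂⟩ := weightedSobolevSeminorm_comp_smul_le (G := E3 →L[ℝ] E3 →L[ℝ] ℝ) hl (s - 1) (δ + 1)
  refine ⟨max K₁ (l * K₂), lt_max_of_lt_left hK₁, fun a M D₁ D₂ ↦ ?_⟩
  have hV : MeasurableSet ((Kerr.slice (l * a) (l * M) : Opens E3) : Set E3) :=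
    (Kerr.slice (l * a) (l * M)).isOpen.measurableSet
  have hUV : ∀ y : E3, y ∈ ((Kerr.slice a M : Opens E3) : Set E3) ↔
      l • y ∈ ((Kerr.slice (l * a) (l * M) : Opens E3) : Set E3) := fun y ↦
    (Kerr.mem_slice_dilate_iff hl).symm
  unfold InitialDataSet.dataWeightedSobolevEDist
  -- the component differences of the shrinks
  have hh : ((D₁.comap (Kerr.sliceShrinkHomeomorph l hl a M).symm (sliceScale_smooth hl a M).1
        (sliceScale_smooth hl a M).2).homothety l⁻¹ (inv_pos.2 hl)).hFun -
      ((D₂.comap (Kerr.sliceShrinkHomeomorph l hl a M).symm (sliceScale_smooth hl a M).1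
        (sliceScale_smooth hl a M).2).homothety l⁻¹ (inv_pos.2 hl)).hFun =
      fun y ↦ (D₁.hFun - D₂.hFun) (l • y) := by
    funext y
    simp only [Pi.sub_apply, hFun_shrink hl]
  have hk : ((D₁.comap (Kerr.sliceShrinkHomeomorph l hl a M).symm (sliceScale_smooth hl a M).1
        (sliceScale_smooth hl a M).2).homothety l⁻¹ (inv_pos.2 hl)).kFun -
      ((D₂.comap (Kerr.sliceShrinkHomeomorph l hl a M).symm (sliceScale_smooth hl a M).1
        (sliceScale_smooth hl a M).2).homothety l⁻¹ (inv_pos.2 hl)).kFun =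
      l • fun y ↦ (D₁.kFun - D₂.kFun) (l • y) := by
    funext y
    simp only [Pi.sub_apply, Pi.smul_apply, kFun_shrink hl]
    refine ContinuousLinearMap.ext fun v ↦ ContinuousLinearMap.ext fun w ↦ ?_
    simp [mul_sub]
  rw [hh, hk]
  have e1 := H₁ _ _ hV hUV (D₁.hFun - D₂.hFun)
  have e2 := (weightedSobolevSeminorm_const_smul_le ((Kerr.slice a M : Opens E3) : Set E3) (s - 1) (δ + 1)
    (fun y ↦ (D₁.kFun - D₂.kFun) (l • y)) hl.ne').trans
    (mul_le_mul' le_rfl (H₂ _ _ hV hUV (D₁.kFun - D₂.kFun)))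
  rw [abs_of_pos hl, ← mul_assoc, ← ENNReal.ofReal_mul hl.le] at e2
  have hK1 : ENNReal.ofReal K₁ ≤ ENNReal.ofReal (max K₁ (l * K₂)) := ENNReal.ofReal_le_ofReal (le_max_left _ _)
  have hK2 : ENNReal.ofReal (l * K₂) ≤ ENNReal.ofReal (max K₁ (l * K₂)) :=
    ENNReal.ofReal_le_ofReal (le_max_right _ _)
  calc _ ≤ ENNReal.ofReal K₁ * weightedSobolevSeminorm ((Kerr.slice (l * a) (l * M) : Opens E3) : Set E3) s δ
          (D₁.hFun - D₂.hFun) +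
        ENNReal.ofReal (l * K₂) * weightedSobolevSeminorm ((Kerr.slice (l * a) (l * M) : Opens E3) : Set E3)
          (s - 1) (δ + 1) (D₁.kFun - D₂.kFun) := add_le_add e1 e2
    _ ≤ ENNReal.ofReal (max K₁ (l * K₂)) *
          weightedSobolevSeminorm ((Kerr.slice (l * a) (l * M) : Opens E3) : Set E3) s δ (D₁.hFun - D₂.hFun) +
        ENNReal.ofReal (max K₁ (l * K₂)) * weightedSobolevSeminorm
          ((Kerr.slice (l * a) (l * M) : Opens E3) : Set E3) (s - 1) (δ + 1) (D₁.kFun - D₂.kFun) :=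
        add_le_add (mul_le_mul' hK1 le_rfl) (mul_le_mul' hK2 le_rfl)
    _ = _ := by rw [mul_add]

end Distance

/-- **Registered sub-goal `stub_dataWeightedSobolevEDist_shrink_le`** (crux item stmt-FinalStateConjecture-14985): the
`H^s_δ × H^{s-1}_{δ+1}` distance of two shrinks is controlled by the distance of the data, with a constant depending
only on `(l, s, δ)` (closed form of `dataWeightedSobolevEDist_shrink_le`). [cite: Bartnik1986, (1.2)] -/
theorem stub_dataWeightedSobolevEDist_shrink_le : ∀ (l : ℝ) (hl : 0 < l) (s : ℕ) (δ : ℝ), ∃ K : ℝ, 0 < K ∧ ∀ (a M : ℝ) (D₁ D₂ : InitialDataSet 𝓘(ℝ, E3) (Kerr.slice (l * a) (l * M))), InitialDataSet.dataWeightedSobolevEDist s δ ((D₁.comap (Kerr.sliceShrinkHomeomorph l hl a M).symm (sliceScale_smooth hl a M).1 (sliceScale_smooth hl a M).2).homothety l⁻¹ (inv_pos.2 hl)) ((D₂.comap (Kerr.sliceShrinkHomeomorph l hl a M).symm (sliceScale_smooth hl a M).1 (sliceScale_smooth hl a M).2).homothety l⁻¹ (inv_pos.2 hl)) ≤ ENNReal.ofReal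 K * InitialDataSet.dataWeightedSobolevEDist s δ D₁ D₂ :=
  fun _ hl s δ ↦ dataWeightedSobolevEDist_shrink_le hl s δ

end Summit.FinalStateConjecture.FinalStateConjecture.Theorems.BulkKerrCaptureC2.Scaling

end
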